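import Summits.QuantumFields.YangMills.Theorems.IR.SCFloorTorusOffDiag
import Summits.QuantumFields.YangMills.Theorems.IR.SCFloorSchwarz

/-!
# Strong-coupling floor engine, part 15: non-facing plaquettes in adjacent slices — the VOLUME-UNIFORM `O(β⁵)` bound

Pooled prover `ym-ir-line-bsf-p1` (crux `IR`, stmt-QuantumFields-19354), support for the consumer rung R2 of line
`momentum-pincer` (`NoLightMoversSCTransfer`).  For the torus Wilson state on `(ℤ/L)⁴`, `L ≥ 3`, and every site `y`
with `y 0 = 1`, `y ≠ e₀`: `|Cov_{L,b}(Re tr ρ(U_{(0;1,2)}), Re tr ρ(U_{(y;1,2)}))| ≤ K' (b/r)⁵` for `0 ≤ b ≤ r`, with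
`K', r > 0` depending only on `ρ` — NOT on `L` or `y` (`cov_offdiag_schwarz`).  Proof = part 10 verbatim without the
`b⁴` term: holomorphy and the volume-uniform disc bound of the complex truncated expectation (tree Osterwalder–Seiler
machinery, seed counts `≤ 8·2⁴·16` for any two plaquettes), analytic order `≥ 5` at `0` from part 14 on each torus
(`isBigO_pow_of_real_bound`), Schwarz lemma with multiplicity (tree `norm_le_of_isBigO_pow`).  These are the
off-diagonal terms of the slice sum `s(1) = Σ_{x⃗} Cov(P_{(0,x⃗)}, P_{(1,0⃗)})`, one order above the diagonal `β⁴` law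
of part 11.  HONEST: strong coupling only; nothing here bears on the Yang–Mills mass gap.
-/

set_option autoImplicit false

noncomputable section

open MeasureTheory Filter Topology Function Finset Asymptotics
open Literature.MathematicalPhysics.QuantumFieldTheory
open Literature.MathematicalPhysics.QuantumLattice (haarConv plaquetteObs torusLift toTorusObservable LGConfig
  plaquetteHolonomyZd)

namespace Summit.QuantumFields.YangMills.Cruxes.IR.SCFloor

variable {G : Type} [Group G] [TopologicalSpace G] [IsTopologicalGroup G] [CompactSpace G] [MeasurableSpace G]
  [BorelSpace G] [SecondCountableTopology G] [T2Space G] {N : ℕ} (ρ : G →* Matrix (Fin N) (Fin N) ℂ)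

/-- **Non-facing plaquettes in adjacent time slices: `|Cov| ≤ K'(b/r)⁵` UNIFORMLY IN THE VOLUME AND THE POSITION.**
There are `K'` and `r > 0` (depending only on `ρ`) such that on every torus `(ℤ/L)⁴`, `L ≥ 3`, for every site `y`
with `y 0 = 1` and `y ≠ e₀`, and every `0 ≤ b ≤ r`:
`|Cov_{wilsonMeasure ρ b}(Re tr ρ(U_{(0;1,2)}), Re tr ρ(U_{(y;1,2)}))| ≤ K' (b/r)⁵`. -/
theorem cov_offdiag_schwarz (hρ : Continuous ρ) :
    ∃ K' r : ℝ, 0 < r ∧ ∀ (L : ℕ) [NeZero L], 3 ≤ L → ∀ y : Site 4 L, y 0 = 1 → y ≠ (0 : Site 4 L).shift 0 →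
      ∀ b : ℝ, 0 ≤ b → b ≤ r →
      |(∫ U, (ρ (plaquetteHolonomy U 0 1 2)).trace.re * (ρ (plaquetteHolonomy U y 1 2)).trace.re
            ∂(wilsonMeasure (d := 4) (L := L) ρ b)) -
          (∫ U, (ρ (plaquetteHolonomy U 0 1 2)).trace.re ∂(wilsonMeasure (d := 4) (L := L) ρ b)) *
            ∫ U, (ρ (plaquetteHolonomy U y 1 2)).trace.re
              ∂(wilsonMeasure (d := 4) (L := L) ρ b)| ≤ K' * (b / r) ^ 5 := by
  classical
  -- uniform bounds on the observables
  obtain ⟨Ctr, hCtr0, hCtr⟩ := exists_bound_trace_re_nonneg (ρ := ρ) hρ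
  -- the disc radius and the constants (uniform in `L`)
  set R : ℝ := betaOne 4 ρ with hRdef
  have hR0 : 0 < R := betaOne_pos 4 (ρ := ρ)
  set r : ℝ := R / 2 with hrdef
  have hr : 0 < r := by positivity
  have hrR : r < R := by rw [hrdef]; linarith
  set κ : ℝ := 2 * Real.exp (1 / 2) with hκ
  have hκ1 : 1 ≤ κ := by
    rw [hκ]; have := Real.one_lt_exp_iff.2 (by norm_num : (0 : ℝ) < 1 / 2); linarith
  set sB : ℕ := 8 * (2 ^ 4 * (4 * 4)) with hsB
  set Kc : ℝ := Ctr * Ctr * κ ^ sB + Ctr * κ ^ sB * (Ctr * κ ^ sB) with hKc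
  refine ⟨Kc, r, hr, fun L _ hL y hy0 hy b hb0 hbr => ?_⟩
  haveI : Fact (1 < L) := ⟨by omega⟩
  -- part 14 on this torus (real axis)
  obtain ⟨K, b₁, hb₁, htorus⟩ := torus_cov_offdiag_estimate (L := L) ρ hρ hL 0 y (by simpa using hy0) hy
  -- the observables of `ℤ⁴` and their periodic/twisted versions
  set x₀ : Literature.Probability.LatticeModels.Site 4 := 0 with hx₀
  set x₁ : Literature.Probability.LatticeModels.Site 4 := fun k => ((y k).val : ℤ) with hx₁
  set F₁ : LGConfig 4 G → ℝ := plaquetteObs ρ x₀ 1 2 with hF₁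
  set F₂ : LGConfig 4 G → ℝ := plaquetteObs ρ x₁ 1 2 with hF₂
  have hF₁m : Measurable F₁ := measurable_trace_re_plaquette ρ hρ x₀ 1 2
  have hF₂m : Measurable F₂ := measurable_trace_re_plaquette ρ hρ x₁ 1 2
  have hF₁b : ∀ U, |F₁ U| ≤ Ctr := fun U => by simp only [hF₁]; exact hCtr _
  have hF₂b : ∀ U, |F₂ U| ≤ Ctr := fun U => by simp only [hF₂]; exact hCtr _
  have hF12m : Measurable fun U => F₁ U * F₂ U := hF₁m.mul hF₂m
  have hF12b : ∀ U, |F₁ U * F₂ U| ≤ Ctr * Ctr := fun U => by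
    rw [abs_mul]; exact mul_le_mul (hF₁b U) (hF₂b U) (abs_nonneg _) hCtr0
  -- torus observables are the plaquette traces of the statement
  have hp0 : (Literature.Probability.LatticeModels.Torus.proj L x₀ : Site 4 L) = 0 := by
    funext k; simp [hx₀, Literature.Probability.LatticeModels.Torus.proj_apply]
  have hp1 : (Literature.Probability.LatticeModels.Torus.proj L x₁ : Site 4 L) = y := by
    funext k; simp [hx₁, Literature.Probability.LatticeModels.Torus.proj_apply]
  have hT₁ : toTorusObservable L F₁ = fun U : GaugeConfig 4 L G => (ρ (plaquetteHolonomy U 0 1 2)).trace.re := by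
    rw [hF₁, toTorusObservable_plaquetteObs_eq, hp0]
  have hT₂ : toTorusObservable L F₂ = fun U : GaugeConfig 4 L G =>
      (ρ (plaquetteHolonomy U y 1 2)).trace.re := by
    rw [hF₂, toTorusObservable_plaquetteObs_eq, hp1]
  have hT₁₂ : toTorusObservable L (fun U => F₁ U * F₂ U) = fun U : GaugeConfig 4 L G =>
      (ρ (plaquetteHolonomy U 0 1 2)).trace.re * (ρ (plaquetteHolonomy U y 1 2)).trace.re := by
    funext U
    have h1 := congrFun hT₁ U
    have h2 := congrFun hT₂ U
    simp only [toTorusObservable, Function.comp_apply] at h1 h2 ⊢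
    rw [h1, h2]
  -- the complex truncated expectation
  set S := torusSystem (d := 4) (G := G) ρ L with hSdef
  have hReg : S.Regular (costBound ρ) (Plaq.degBound 4) := torusSystem_regular ρ hρ
  set V := torusGenuine 4 L with hV
  set Φ₁ : ZdGaugeConfig 4 G → ℂ := fun U => (F₁ (U ∘ torusRed L) : ℂ) with hΦ₁
  set Φ₂ : ZdGaugeConfig 4 G → ℂ := fun U => (F₂ (U ∘ torusRed L) : ℂ) with hΦ₂
  have hΦ₁m : Measurable Φ₁ := Complex.measurable_ofReal.comp (hF₁m.comp (measurable_comp_relabel (torusRed L)))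
  have hΦ₂m : Measurable Φ₂ := Complex.measurable_ofReal.comp (hF₂m.comp (measurable_comp_relabel (torusRed L)))
  have hΦ₁b : ∀ U, ‖Φ₁ U‖ ≤ Ctr := fun U => by rw [hΦ₁, Complex.norm_real, Real.norm_eq_abs]; exact hF₁b _
  have hΦ₂b : ∀ U, ‖Φ₂ U‖ ≤ Ctr := fun U => by rw [hΦ₂, Complex.norm_real, Real.norm_eq_abs]; exact hF₂b _
  have h12d : ((1 : Fin 4), (2 : Fin 4)).1 < ((1 : Fin 4), (2 : Fin 4)).2 := by decide
  set P0z : Literature.MathematicalPhysics.QuantumLattice.ZdPlaquette 4 := (x₀, ⟨((1 : Fin 4), (2 : Fin 4)), h12d⟩) with hP0z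
  set P1z : Literature.MathematicalPhysics.QuantumLattice.ZdPlaquette 4 := (x₁, ⟨((1 : Fin 4), (2 : Fin 4)), h12d⟩) with hP1z
  set B₁ : Finset (ZdEdge 4) := Literature.MathematicalPhysics.QuantumLattice.plaquetteEdges P0z with hB₁
  set B₂ : Finset (ZdEdge 4) := Literature.MathematicalPhysics.QuantumLattice.plaquetteEdges P1z with hB₂
  have hF₁d : DependsOn F₁ (B₁ : Set (ZdEdge 4)) :=
    Literature.MathematicalPhysics.QuantumLattice.isCylinder_plaquetteObs (G := G) ρ P0z
  have hF₂d : DependsOn F₂ (B₂ : Set (ZdEdge 4)) :=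
    Literature.MathematicalPhysics.QuantumLattice.isCylinder_plaquetteObs (G := G) ρ P1z
  have hΦ₁d : DependsOn Φ₁ ((B₁.image (torusRed L) : Finset (ZdEdge 4)) : Set (ZdEdge 4)) :=
    dependsOn_comp_torusRed L (F := fun U => (F₁ U : ℂ)) fun U W h => by
      show (F₁ U : ℂ) = F₁ W; rw [hF₁d h]
  have hΦ₂d : DependsOn Φ₂ ((B₂.image (torusRed L) : Finset (ZdEdge 4)) : Set (ZdEdge 4)) :=
    dependsOn_comp_torusRed L (F := fun U => (F₂ U : ℂ)) fun U W h => by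
      show (F₂ U : ℂ) = F₂ W; rw [hF₂d h]
  -- seed counts, uniformly in `L`
  have hB₁c : B₁.card ≤ 4 := Finset.card_le_four
  have hB₂c : B₂.card ≤ 4 := Finset.card_le_four
  have hs₁ : (S.seedsOf (B₁.image (torusRed L))).card ≤ sB := by
    refine (card_seedsOf_torusSystem_le ρ B₁).trans ((card_seedsOf_le_mul B₁).trans ?_)
    rw [hsB]; exact Nat.mul_le_mul_right _ (by omega)
  have hs₂ : (S.seedsOf (B₂.image (torusRed L))).card ≤ sB := by
    refine (card_seedsOf_torusSystem_le ρ B₂).trans ((card_seedsOf_le_mul B₂).trans ?_)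
    rw [hsB]; exact Nat.mul_le_mul_right _ (by omega)
  have hs₁₂ : (S.seedsOf (B₁.image (torusRed L) ∪ B₂.image (torusRed L))).card ≤ sB := by
    rw [← Finset.image_union]
    refine (card_seedsOf_torusSystem_le ρ _).trans ((card_seedsOf_le_mul _).trans ?_)
    rw [hsB]
    exact Nat.mul_le_mul_right _ ((Finset.card_union_le _ _).trans (by omega))
  -- the holomorphic function `G(β) = ⟨Φ₁Φ₂⟩ − ⟨Φ₁⟩⟨Φ₂⟩`
  set Gf : ℂ → ℂ := fun β => S.expect (fun U => Φ₁ U * Φ₂ U) V β - S.expect Φ₁ V β * S.expect Φ₂ V β with hGf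
  have h12 : ∀ U, ‖Φ₁ U * Φ₂ U‖ ≤ Ctr * Ctr := fun U => by
    rw [norm_mul]; exact mul_le_mul (hΦ₁b U) (hΦ₂b U) (norm_nonneg _) hCtr0
  have hdiff : DifferentiableOn ℂ Gf (Metric.ball 0 (PlaqSystem.betaR (costBound ρ) (Plaq.degBound 4))) :=
    (PlaqSystem.differentiableOn_expect hReg (hΦ₁m.mul hΦ₂m) h12 V).sub
      ((PlaqSystem.differentiableOn_expect hReg hΦ₁m hΦ₁b V).mul
        (PlaqSystem.differentiableOn_expect hReg hΦ₂m hΦ₂b V))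
  have hRβ : PlaqSystem.betaR (costBound ρ) (Plaq.degBound 4) = R := by rw [hRdef, betaR_costBound]
  have hbound : ∀ z ∈ Metric.ball (0 : ℂ) (PlaqSystem.betaR (costBound ρ) (Plaq.degBound 4)), ‖Gf z‖ ≤ Kc := by
    intro z hz
    have hz' : ‖z‖ ≤ PlaqSystem.betaR (costBound ρ) (Plaq.degBound 4) := le_of_lt (mem_ball_zero_iff.1 hz)
    have htr := PlaqSystem.norm_truncatedExpect_le_const hReg hz' hΦ₁m hΦ₂m hΦ₁b hΦ₂b hΦ₁d hΦ₂d V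
    calc ‖Gf z‖ ≤ Ctr * Ctr * κ ^ sB + Ctr * κ ^ sB * (Ctr * κ ^ sB) := by
          refine htr.trans ?_
          exact add_le_add (mul_le_mul_of_nonneg_left (pow_le_pow_right₀ hκ1 hs₁₂) (by positivity))
              (mul_le_mul (mul_le_mul_of_nonneg_left (pow_le_pow_right₀ hκ1 hs₁) hCtr0)
                (mul_le_mul_of_nonneg_left (pow_le_pow_right₀ hκ1 hs₂) hCtr0) (by positivity) (by positivity))
      _ = Kc := by rw [hKc]
  -- on the real axis `Gf t` is the real covariance
  have hreal_eq : ∀ t : ℝ, Gf t =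
      (((∫ U, (ρ (plaquetteHolonomy U 0 1 2)).trace.re * (ρ (plaquetteHolonomy U y 1 2)).trace.re
            ∂(wilsonMeasure (d := 4) (L := L) ρ t)) -
          (∫ U, (ρ (plaquetteHolonomy U 0 1 2)).trace.re ∂(wilsonMeasure (d := 4) (L := L) ρ t)) *
            ∫ U, (ρ (plaquetteHolonomy U y 1 2)).trace.re
              ∂(wilsonMeasure (d := 4) (L := L) ρ t) : ℝ) : ℂ) := by
    intro t
    have e12 := wilsonExpectation_toTorusObservable_eq_re_expect (L := L) ρ hρ t hF12m hF12b
    have e1 := wilsonExpectation_toTorusObservable_eq_re_expect (L := L) ρ hρ t hF₁m hF₁b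
    have e2 := wilsonExpectation_toTorusObservable_eq_re_expect (L := L) ρ hρ t hF₂m hF₂b
    rw [hT₁₂] at e12; rw [hT₁] at e1; rw [hT₂] at e2
    simp only [wilsonExpectation] at e12 e1 e2
    have i12 := PlaqSystem.expect_ofReal_im (S := S) (fun U => F₁ (U ∘ torusRed L) * F₂ (U ∘ torusRed L)) V t
    have i1 := PlaqSystem.expect_ofReal_im (S := S) (fun U => F₁ (U ∘ torusRed L)) V t
    have i2 := PlaqSystem.expect_ofReal_im (S := S) (fun U => F₂ (U ∘ torusRed L)) V t
    have c1 : S.expect Φ₁ V t =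
        ((∫ U, (ρ (plaquetteHolonomy U 0 1 2)).trace.re ∂(wilsonMeasure (d := 4) (L := L) ρ t) : ℝ) : ℂ) :=
      Complex.ext (by rw [Complex.ofReal_re]; exact e1.symm) (by rw [Complex.ofReal_im]; exact i1)
    have c2 : S.expect Φ₂ V t =
        ((∫ U, (ρ (plaquetteHolonomy U y 1 2)).trace.re
          ∂(wilsonMeasure (d := 4) (L := L) ρ t) : ℝ) : ℂ) :=
      Complex.ext (by rw [Complex.ofReal_re]; exact e2.symm) (by rw [Complex.ofReal_im]; exact i2)
    have hprod : (fun U : ZdGaugeConfig 4 G => Φ₁ U * Φ₂ U) =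
        fun U => (((F₁ (U ∘ torusRed L) * F₂ (U ∘ torusRed L)) : ℝ) : ℂ) := by
      funext U; simp only [hΦ₁, hΦ₂]; push_cast; ring
    have c12 : S.expect (fun U => Φ₁ U * Φ₂ U) V t =
        ((∫ U, (ρ (plaquetteHolonomy U 0 1 2)).trace.re * (ρ (plaquetteHolonomy U y 1 2)).trace.re
          ∂(wilsonMeasure (d := 4) (L := L) ρ t) : ℝ) : ℂ) := by
      rw [hprod]
      exact Complex.ext (by rw [Complex.ofReal_re]; exact e12.symm) (by rw [Complex.ofReal_im]; exact i12)
    simp only [hGf]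
    rw [c12, c1, c2]
    push_cast
    ring
  have hreal : ∀ t : ℝ, 0 < t → t ≤ b₁ → ‖Gf t‖ ≤ K * t ^ 5 := by
    intro t ht0 ht1
    rw [hreal_eq t, Complex.norm_real, Real.norm_eq_abs]
    have := htorus t (by rw [abs_of_pos ht0]; exact ht1)
    rwa [abs_of_pos ht0] at this
  -- Schwarz lemma with multiplicity
  have hana : AnalyticAt ℂ Gf 0 :=
    (hdiff.analyticOnNhd (Metric.isOpen_ball)) 0 (Metric.mem_ball_self (by rw [hRβ]; exact hR0))
  have hO := isBigO_pow_of_real_bound hana hb₁ hreal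
  have hSchwarz := norm_le_of_isBigO_pow hdiff hbound hO hr (by rw [hRβ]; exact hrR)
    (z := (b : ℂ)) (by rw [Complex.norm_real, Real.norm_eq_abs, abs_of_nonneg hb0]; exact hbr)
  rw [hreal_eq b, Complex.norm_real, Real.norm_eq_abs, Complex.norm_real, Real.norm_eq_abs, abs_of_nonneg hb0] at hSchwarz
  exact hSchwarz


end Summit.QuantumFields.YangMills.Cruxes.IR.SCFloor

end
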